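import Literature.Probability.RandomPlanarGeometry.TranslatedRectangleDomains

/-!
# The test domains: a rectangle on the real axis with marked points on its bottom side

Helper file for route CardyAnchoredRigidity, item stmt-CriticalPhenomena-14488
(`StretchedPullbackNotTargetBlind`).

The Jordan domain `bigRect = (-10, 10) × (0, 20)` (the tree's `rectDomain 10 10` translated by
`10 i`, `TranslatedRectangleDomains`), with marked points ON THE REAL AXIS: the three-marked domain
`dom3 a = (bigRect; a, 0, 1)` (`a < 0`) in which target independence is tested, and the conformal
rectangles `rect4 a y = (bigRect; a, 0, 1, y)` (`1 < y`) whose crossing events are the test events.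
The two share their Jordan domain and the marks `a, 0, 1`, so `(rect4 a y).chord 0 2 = (dom3 a).chord 0 2`
and `(rect4 a y).arc 1 = (dom3 a).arc 1` hold by `rfl`-type arguments. Elementary; no named facts.
-/

noncomputable section

open Set Metric Complex
open UpperHalfPlane (upperHalfPlaneSet)

namespace Summit.CriticalPhenomena.CardyFormulaZ2.Theorems.StretchedPullback

open Literature.Probability.RandomPlanarGeometry

/-- The rectangle `(-10, 10) × (0, 20)` as a Jordan domain. -/
def bigRect : JordanDomain :=
  (rectDomain 10 10 (by norm_num) (by norm_num)).map (similarity 1 one_ne_zero (((10 : ℝ) : ℂ) * Complex.I))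

/-- Membership in `bigRect`. -/
theorem mem_bigRect {w : ℂ} :
    w ∈ bigRect.carrier ↔ (-10 < w.re ∧ w.re < 10) ∧ (0 < w.im ∧ w.im < 20) := by
  rw [bigRect, mem_carrier_transRect (by norm_num : (0 : ℝ) < 10) (by norm_num : (0 : ℝ) < 10)]
  norm_num

/-- `bigRect` lies in the upper half-plane. -/
theorem bigRect_subset_upperHalfPlaneSet : bigRect.carrier ⊆ upperHalfPlaneSet := fun _ hw =>
  (mem_bigRect.1 hw).2.1

/-- Points of `ℍ` within distance `9` of a real point `c`, `|c| ≤ 1`, lie in `bigRect`. -/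
theorem mem_bigRect_of_norm_sub_lt {c : ℝ} (hc : |c| ≤ 1) {z : ℂ} (hz : ‖z - c‖ < 9)
    (him : 0 < z.im) : z ∈ bigRect.carrier := by
  rw [mem_bigRect]
  have hre : |z.re - c| < 9 := by
    have := abs_re_le_norm (z - c)
    rw [sub_re, ofReal_re] at this
    exact this.trans_lt hz
  have him' : |z.im| < 9 := by
    have := abs_im_le_norm (z - c)
    rw [sub_im, ofReal_im, sub_zero] at this
    exact this.trans_lt hz
  rw [abs_lt] at hre him'
  rw [abs_le] at hc
  exact ⟨⟨by linarith, by linarith⟩, him, by linarith⟩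

/-- The boundary parameter of the bottom point `m ∈ [-10, 10]`. -/
def bparam (m : ℝ) : ℝ := ((m + 10) / 20) / 4

/-- The boundary point of parameter `bparam m` is the real point `m`. -/
theorem bigRect_boundary_bparam {m : ℝ} (hm : m ∈ Icc (-10 : ℝ) 10) :
    bigRect.boundary (bparam m) = (m : ℂ) := by
  have hθ : (m + 10) / 20 ∈ Icc (0 : ℝ) 1 := by
    constructor
    · have := hm.1
      exact div_nonneg (by linarith) (by norm_num)
    · rw [div_le_one (by norm_num)]; linarith [hm.2]
  rw [bigRect, bparam, transRect_boundary_bottom (by norm_num) (by norm_num) 10 hθ]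
  apply Complex.ext
  · simp; ring
  · simp

/-- The parameter lies in the fundamental period. -/
theorem bparam_mem {m : ℝ} (hm : m ∈ Ioo (-10 : ℝ) 10) : bparam m ∈ Ico (0 : ℝ) 1 := by
  simp only [bparam, mem_Ico]
  constructor
  · have := hm.1
    have : 0 ≤ m + 10 := by linarith
    positivity
  · rw [div_div, div_lt_one (by norm_num)]
    linarith [hm.2]

/-- The parameter is strictly increasing in the point. -/
theorem bparam_lt_bparam {m m' : ℝ} (h : m < m') : bparam m < bparam m' := by
  simp only [bparam]
  have : (m + 10) / 20 < (m' + 10) / 20 := by linarith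
  linarith

/-- **The three-marked test domain** `(bigRect; a, 0, 1)`, `-10 < a < 0`. -/
def dom3 (a : ℝ) (ha : a ∈ Ioo (-10 : ℝ) 0) : MarkedDomain 3 where
  toJordanDomain := bigRect
  mark := ![bparam a, bparam 0, bparam 1]
  strictMono_mark := by
    refine Fin.strictMono_iff_lt_succ.2 fun k => ?_
    fin_cases k
    · exact bparam_lt_bparam ha.2
    · exact bparam_lt_bparam zero_lt_one
  mark_mem k := by
    fin_cases k
    · exact bparam_mem ⟨ha.1, by linarith [ha.2]⟩
    · exact bparam_mem ⟨by norm_num, by norm_num⟩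
    · exact bparam_mem ⟨by norm_num, by norm_num⟩

/-- **The test rectangles** `(bigRect; a, 0, 1, y)`, `-10 < a < 0`, `1 < y < 10`. -/
def rect4 (a y : ℝ) (ha : a ∈ Ioo (-10 : ℝ) 0) (hy : y ∈ Ioo (1 : ℝ) 10) : MarkedDomain 4 where
  toJordanDomain := bigRect
  mark := ![bparam a, bparam 0, bparam 1, bparam y]
  strictMono_mark := by
    refine Fin.strictMono_iff_lt_succ.2 fun k => ?_
    fin_cases k
    · exact bparam_lt_bparam ha.2
    · exact bparam_lt_bparam zero_lt_one
    · exact bparam_lt_bparam hy.1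
  mark_mem k := by
    fin_cases k
    · exact bparam_mem ⟨ha.1, by linarith [ha.2]⟩
    · exact bparam_mem ⟨by norm_num, by norm_num⟩
    · exact bparam_mem ⟨by norm_num, by norm_num⟩
    · exact bparam_mem ⟨by linarith [hy.1], hy.2⟩

section Facts

variable {a y : ℝ} (ha : a ∈ Ioo (-10 : ℝ) 0) (hy : y ∈ Ioo (1 : ℝ) 10)

/-- The carrier of `dom3` is `bigRect`. -/
@[simp] theorem dom3_carrier : (dom3 a ha).carrier = bigRect.carrier := rfl

/-- The carrier of `rect4` is `bigRect`. -/
@[simp] theorem rect4_carrier : (rect4 a y ha hy).carrier = bigRect.carrier := rfl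

/-- Marked points of `dom3`: `a`. -/
theorem dom3_pt_zero : (dom3 a ha).pt 0 = (a : ℂ) :=
  bigRect_boundary_bparam ⟨ha.1.le, by linarith [ha.2]⟩

/-- Marked points of `dom3`: `0`. -/
theorem dom3_pt_one : (dom3 a ha).pt 1 = (0 : ℂ) := by
  have := bigRect_boundary_bparam (m := 0) ⟨by norm_num, by norm_num⟩
  rw [ofReal_zero] at this
  exact this

/-- Marked points of `dom3`: `1`. -/
theorem dom3_pt_two : (dom3 a ha).pt 2 = (1 : ℂ) := by
  have := bigRect_boundary_bparam (m := 1) ⟨by norm_num, by norm_num⟩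
  rw [ofReal_one] at this
  exact this

/-- Marked points of `rect4`: `a`. -/
theorem rect4_pt_zero : (rect4 a y ha hy).pt 0 = (a : ℂ) :=
  bigRect_boundary_bparam ⟨ha.1.le, by linarith [ha.2]⟩

/-- Marked points of `rect4`: `0`. -/
theorem rect4_pt_one : (rect4 a y ha hy).pt 1 = (0 : ℂ) := by
  have := bigRect_boundary_bparam (m := 0) ⟨by norm_num, by norm_num⟩
  rw [ofReal_zero] at this
  exact this

/-- Marked points of `rect4`: `1`. -/
theorem rect4_pt_two : (rect4 a y ha hy).pt 2 = (1 : ℂ) := by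
  have := bigRect_boundary_bparam (m := 1) ⟨by norm_num, by norm_num⟩
  rw [ofReal_one] at this
  exact this

/-- Marked points of `rect4`: `y`. -/
theorem rect4_pt_three : (rect4 a y ha hy).pt 3 = (y : ℂ) :=
  bigRect_boundary_bparam ⟨by linarith [hy.1], hy.2.le⟩

/-- The Dobrushin domain `(bigRect; a, 1)` is shared: `(rect4 a y).chord 0 2 = (dom3 a).chord 0 2`. -/
theorem rect4_chord_zero_two :
    (rect4 a y ha hy).chord 0 2 (by decide) = (dom3 a ha).chord 0 2 (by decide) := rfl

/-- So is `(bigRect; a, 0)`: `(rect4 a y).chord 0 1 = (dom3 a).chord 0 1`. -/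
theorem rect4_chord_zero_one :
    (rect4 a y ha hy).chord 0 1 (by decide) = (dom3 a ha).chord 0 1 (by decide) := rfl

/-- The stopping arc `[0, 1]` is shared: `(rect4 a y).arc 1 = (dom3 a).arc 1`. -/
theorem rect4_arc_one : (rect4 a y ha hy).arc 1 = (dom3 a ha).arc 1 := by
  simp only [MarkedDomain.arc, MarkedDomain.nextMark]
  rfl

end Facts

end Summit.CriticalPhenomena.CardyFormulaZ2.Theorems.StretchedPullback
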